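import Literature.Computability.AlgebraicComplexity.PerDetHwvCertificateProofs
import Literature.Computability.AlgebraicComplexity.HwvEvaluationRankBound
import Literature.Computability.AlgebraicComplexity.PerDetMultiplicityObstruction
import Literature.Computability.AlgebraicComplexity.StandardFamiliesProofs
import HarnessLib

/-!
# Glue: from a kernel-verified certificate to a multiplicity obstruction and `dc(per_n) > m`

Topic `Computability/AlgebraicComplexity`; the glue file of the Lean checker of the GCT
multiplicity-obstruction engine (cell `pub-gct`, bundle papers/PneNP/gct-obstructions). HONEST
FRAMING: rung-1 multiplicity-obstruction search for permanent versus determinant at small `(n, m)`;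
no claim about VP ≠ VNP or P ≠ NP; and NO certificate with an actual obstruction exists at the time
of writing — this file says precisely what the kernel would and would not know if one did.

Given a certificate `c : TableauEval.Cert` with `c.verify = true` (kernel arithmetic:
`PerDetHwvCertificate.lean`), what separates it from the tree's statement
`PerDetMultiplicityObstructionAt n m d λ` (`PerDetMultiplicityObstruction.lean`) — and hence from
the PROVED consequence `m < dc(per_n)` — is exactly:

* (H1, **semantics of the highest-weight vectors**) for each row `i` of the minor a polynomial
  function `F_i` on `Sym^m (K^{m×m})` that is a `B`-semi-invariant of weight `λ^*`
  (`highestWeightSpace (coordRep (MatIdx m) K m) ((Weight.dualOfPartition (m·m) λ).toMatIdx)`, the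
  tree's upper-triangular Borel for the contragredient action; for the engine's tableau vectors
  this means reversing the variable order), and for each column `j` a matrix `γ_j` over `K`
  (not necessarily invertible: `γ_j · f` lies in the orbit CLOSURE, which is all the lower bound
  needs), such that `F_i(γ_j · X₀₀^{m-n} per_n)` is the INTEGER `c.evalInt i j` computed by the
  Lean evaluator — packaged, with no axioms, as the hypothesis structure `Cert.Semantics`;
  discharging it in general is the subject of later files (the tableau polynomial, its weight, and
  the independence of `TableauEval.evalC` from the chosen sum-of-products presentation);
* (H2, **the det-side number**) `sk(λ, m×d) ≤ c.sk` for the tree's `symKroneckerCoeffRect` (whose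
  bound `mult_{λ^*} K[Δ(det_m)] ≤ sk(λ, m×d)`, BLMW 2011 Prop. 5.2.1, is PROVED in the tree:
  `orbitMultiplicity_det_le_symKroneckerCoeffRect`); the cell certifies the number `c.sk` by two
  independent engines, and on closed small instances the tree's Murnaghan–Nakayama evaluator
  (`DetOrbitSymKroneckerBoundEval.lean`) can decide it in the kernel.

Under (H1) alone the kernel proves the perm-side LOWER BOUND
`c.r ≤ mult_{λ^*} K[Δ(X₀₀^{m-n} per_n)]` (`Cert.le_orbitMultiplicity_of_verify`: the verified
minor is nonzero mod `p`, hence over `ℤ` by naturality `Cert.entry_eq_cast_evalInt` and the bridge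
`detL_eq_det`, hence over `K`, and `le_orbitMultiplicity_of_det_eval_ne_zero_of_mem_orbitClosure`
applies, the padded permanent being a nonzero form of degree `m`, `paddedPerFormLex_ne_zero`);
adding
(H2) and `sk < r` (checked by `verify`) gives `PerDetSymKroneckerObstructionAt`, hence
`PerDetMultiplicityObstructionAt` (`Cert.perDetMultiplicityObstructionAt_of_verify`) and
`m < dc(per_n)`
(`Cert.lt_determinantalComplexity_of_verify`, via the tree's
`lt_determinantalComplexity_perPoly_of_perDetMultiplicityObstructionAt`).

Contents: §1 unpacking `verify = true`; §2 the partition and weight of a certificate; §3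
`Cert.Semantics`; §4 the three theorems. All bookkeeping is [folklore]; the mathematics is in the
imported files and their citations.
-/

noncomputable section

open MvPolynomial

namespace Literature.Computability.AlgebraicComplexity

namespace TableauEval

open _root_.Literature.NumberTheory.DiophantineGeometry

namespace Cert

/-! ## §1 Unpacking `verify = true` -/

/-- The structural consequences of `c.structural = true` used below. [folklore] -/
theorem spec_of_structural (c : Cert) (h : c.structural = true) :
    0 < c.m ∧ c.n ≤ c.m ∧ c.lam.length ≤ c.m * c.m ∧ c.lam.sum = c.m * c.d ∧
      (∀ a ∈ c.lam, 0 < a) ∧ c.rows.length = c.cols.length ∧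
      (∀ i ∈ c.rows, i < c.hwvs.length) ∧ (∀ j ∈ c.cols, j < c.points.length) ∧ c.sk < c.r := by
  simp only [structural, Bool.and_eq_true, decide_eq_true_eq, List.all_eq_true, beq_iff_eq,
    and_assoc] at h
  obtain ⟨h1, h2, h3, h4, h5, -, -, -, h9, -, -, h12, h13, -, -, h16⟩ := h
  exact ⟨h1, h2, h3, h4, h5, h9, h12, h13, h16⟩

/-- `verify = true` gives the structural part. [folklore] -/
theorem structural_of_verify (c : Cert) (h : c.verify = true) : c.structural = true := by
  simp only [verify, Bool.and_eq_true] at h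
  exact h.1.1

/-- `verify = true` gives a first modulus whose arithmetic checks pass. [folklore] -/
theorem exists_arith_of_verify (c : Cert) (h : c.verify = true) :
    ∃ p ps, c.primes = p :: ps ∧ c.arith 0 p = true := by
  simp only [verify, Bool.and_eq_true, Bool.not_eq_true', List.isEmpty_eq_false_iff,
    ne_eq] at h
  obtain ⟨⟨-, hne⟩, hall⟩ := h
  match hp : c.primes with
  | [] => exact absurd hp hne
  | p :: ps =>
    rw [hp, arithAll, Bool.and_eq_true] at hall
    exact ⟨p, ps, rfl, hall.1⟩

/-- The arithmetic check gives a nonzero list determinant of the recomputed minor. [folklore] -/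
theorem detL_minor_ne_zero_of_arith (c : Cert) {π p : ℕ} (h : c.arith π p = true) :
    detL c.r (c.minor p) ≠ 0 := by
  simp only [arith, Bool.and_eq_true, decide_eq_true_eq] at h
  exact h.2

/-- The positivity of the parts of `λ` from `verify`. [folklore] -/
theorem lam_pos_of_verify (c : Cert) (h : c.verify = true) : ∀ a ∈ c.lam, 0 < a :=
  (c.spec_of_structural (c.structural_of_verify h)).2.2.2.2.1

/-- `λ ⊢ m·d` from `verify`. [folklore] -/
theorem lam_sum_of_verify (c : Cert) (h : c.verify = true) : c.lam.sum = c.m * c.d :=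
  (c.spec_of_structural (c.structural_of_verify h)).2.2.2.1

/-! ## §2 The partition and the weight of a certificate -/

/-- The partition `λ ⊢ m·d` of a certificate (from its list of parts, given positivity and the
sum). [folklore] -/
def lamPartition (c : Cert) (hpos : ∀ a ∈ c.lam, 0 < a) (hsum : c.lam.sum = c.m * c.d) :
    Nat.Partition (c.m * c.d) where
  parts := (c.lam : Multiset ℕ)
  parts_pos ha := hpos _ (Multiset.mem_coe.mp ha)
  parts_sum := by rw [Multiset.sum_coe, hsum]

/-- The number of parts of `lamPartition` is the length of the list. [folklore] -/
theorem card_lamPartition (c : Cert) (hpos : ∀ a ∈ c.lam, 0 < a) (hsum : c.lam.sum = c.m * c.d) :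
    (c.lamPartition hpos hsum).parts.card = c.lam.length := by
  simp [lamPartition]

/-- The weight `λ^*` of `GL_{m²}` on the matrix space, in the convention of
`PerDetMultiplicityObstructionAt` (`(Weight.dualOfPartition (m·m) λ).toMatIdx`). [folklore] -/
def weight (c : Cert) (hpos : ∀ a ∈ c.lam, 0 < a) (hsum : c.lam.sum = c.m * c.d) :
    Weight (MatIdx c.m) :=
  (Weight.dualOfPartition (c.m * c.m) (c.lamPartition hpos hsum)).toMatIdx

/-! ## §3 The hypothesis structure: semantics of the certificate's vectors and points -/

/-- **Semantics of a certificate** over a field `K` (in `Type`, as the tree's obstruction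
statements) for a weight `χ` (hypothesis structure, no
axioms): polynomial functions `F i` on `Sym^m (K^{m×m})`, `B`-semi-invariant of weight `χ` for the
rows of the minor, and matrices `γ j ∈ K^{m² × m²}` for its columns (any matrices: the points
`γ_j · X₀₀^{m-n} per_n` lie in the orbit closure), whose evaluations `F_i(γ_j · X₀₀^{m-n} per_n)`
are the integers `c.evalInt i j` of the Lean evaluator. For the
engine's tableau vectors and `χ = λ^*` this is the content of the Bürgisser–Ikenmeyer /
Dörfler–Ikenmeyer–Panova construction (first-variable alternators are semi-invariants for the
LOWER Borel; compose with the order-reversing permutation of the variables) together with the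
independence of the evaluation from the sum-of-products presentation; both are to be discharged by
later files, until then every consequence is CONDITIONAL on this structure. [folklore] -/
structure Semantics (c : Cert) [NeZero c.m] (K : Type) [Field K] (χ : Weight (MatIdx c.m)) where
  /-- the polynomial function on forms attached to network `i` -/
  F : ℕ → MvPolynomial (DegIdx (MatIdx c.m) c.m) K
  /-- rows of the minor are `B`-semi-invariants of weight `χ` -/
  mem : ∀ i ∈ c.rows, F i ∈ highestWeightSpace (coordRep (MatIdx c.m) K c.m) χ
  /-- the matrix attached to point `j` -/
  γ : ℕ → Matrix (MatIdx c.m) (MatIdx c.m) K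
  /-- the evaluator computes `F_i (γ_j · X₀₀^{m-n} per_n)` -/
  eval_eq : ∀ i ∈ c.rows, ∀ j ∈ c.cols,
    aeval (formCoeff c.m (linSubst (MatIdx c.m) K (γ j) (paddedPerFormLex K c.n c.m))) (F i) =
      (c.evalInt i j : K)

/-! ## §4 From `verify = true` to the bounds -/

/-- The padded permanent `X₀₀^{m-n} per_n` (lexicographic matrix variables) is a nonzero
polynomial over any field: `per_n ≠ 0` (`perPoly_ne_zero`), a power of a variable is nonzero, and
`rename` along injections is injective. [folklore] -/
theorem paddedPerFormLex_ne_zero (K : Type) [Field K] (n m : ℕ) [NeZero m] :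
    paddedPerFormLex K n m ≠ 0 := by
  have hinj : Function.Injective
      (fun ij : BlockIdx n m × BlockIdx n m => ((ij.1 : Fin m), (ij.2 : Fin m))) := by
    intro a b h
    simp only [Prod.mk.injEq] at h
    exact Prod.ext (Subtype.ext h.1) (Subtype.ext h.2)
  have hper : rename (fun ij : BlockIdx n m × BlockIdx n m => ((ij.1 : Fin m), (ij.2 : Fin m)))
      (perPoly (BlockIdx n m) K) ≠ 0 := fun h =>
    perPoly_ne_zero (BlockIdx n m) K (rename_injective _ hinj (by rw [h, map_zero]))
  have hpad : paddedPerPoly K n m ≠ 0 := mul_ne_zero (pow_ne_zero _ (X_ne_zero _)) hper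
  intro h
  exact hpad (rename_injective _ toLex.injective (by
    rw [← paddedPerFormLex.eq_1]  -- `paddedPerFormLex K n m = rename toLex (paddedPerPoly K n m)`
    rw [h, map_zero]))

/-- Entries of the recomputed minor inside the range. [folklore] -/
theorem getD_minor (c : Cert) (p : ℕ) {a b : ℕ} (ha : a < c.rows.length) (hb : b < c.cols.length) :
    ((c.minor p).getD a []).getD b 0 = c.entry p (c.rows.getD a 0) (c.cols.getD b 0) := by
  have h1 : (c.minor p).getD a [] = c.cols.map fun j => c.entry p (c.rows.getD a 0) j := by
    unfold minor
    rw [List.getD_eq_getElem _ _ (by simpa using ha), List.getElem_map,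
      List.getD_eq_getElem _ _ ha]
  rw [h1, List.getD_eq_getElem _ _ (by simpa using hb), List.getElem_map,
    List.getD_eq_getElem _ _ hb]

/-- The integer evaluation matrix of the minor. [folklore] -/
def intMinor (c : Cert) : Matrix (Fin c.r) (Fin c.r) ℤ :=
  Matrix.of fun a b => c.evalInt (c.rows.getD a 0) (c.cols.getD b 0)

/-- `verify = true` makes the integer evaluation matrix nonsingular: its reduction modulo the first
listed modulus is the recomputed minor, whose `detL` — equal to `Matrix.det` by `detL_eq_det` — is
nonzero. [folklore] -/
theorem det_intMinor_ne_zero (c : Cert) (h : c.verify = true) : c.intMinor.det ≠ 0 := by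
  obtain ⟨p, ps, -, harith⟩ := c.exists_arith_of_verify h
  have hS := c.spec_of_structural (c.structural_of_verify h)
  have hrc : c.rows.length = c.cols.length := hS.2.2.2.2.2.1
  have hne := c.detL_minor_ne_zero_of_arith harith
  -- the recomputed minor is the reduction of the integer matrix
  have hmat : matOfRows c.r (c.minor p) = (Int.castRingHom (ZMod p)).mapMatrix c.intMinor := by
    ext a b
    rw [matOfRows, Matrix.of_apply, c.getD_minor p a.isLt (by rw [← hrc]; exact b.isLt),
      RingHom.mapMatrix_apply,
      Matrix.map_apply, intMinor, Matrix.of_apply, entry_eq_cast_evalInt]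
  have hlen : (c.minor p).length = c.r := by simp [minor, r]
  have hrows : ∀ row ∈ c.minor p, row.length = c.r := by
    intro row hrow
    obtain ⟨i, -, rfl⟩ := List.mem_map.mp hrow
    simp [r, hrc]
  rw [detL_eq_det c.r (c.minor p) hlen hrows, hmat, ← RingHom.map_det] at hne
  exact fun h0 => hne (by rw [h0, map_zero])

/-- **Perm-side lower bound from a verified certificate** (conditional on `Semantics`): over a
field `K` of characteristic zero, `c.r ≤ mult_χ K[Δ(X₀₀^{m-n} per_n)]`. The kernel-checked
arithmetic supplies a nonsingular integer evaluation matrix (`det_intMinor_ne_zero`); `Semantics`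
identifies it with the evaluation matrix of semi-invariants at points of the orbit;
`le_orbitMultiplicity_of_det_eval_ne_zero_of_mem_orbitClosure` concludes. [folklore] -/
theorem le_orbitMultiplicity_of_verify (c : Cert) [NeZero c.m] {K : Type} [Field K] [CharZero K]
    {χ : Weight (MatIdx c.m)} (S : c.Semantics K χ) (h : c.verify = true) :
    c.r ≤ orbitMultiplicity K (paddedPerFormLex K c.n c.m) c.m χ := by
  haveI : Infinite K := CharZero.infinite K
  have hS := c.spec_of_structural (c.structural_of_verify h)
  have hrc : c.rows.length = c.cols.length := hS.2.2.2.2.2.1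
  have hm : c.m ≠ 0 := (NeZero.ne c.m)
  have hnm : c.n ≤ c.m := hS.2.1
  -- the data restricted to the minor
  let F' : Fin c.r → MvPolynomial (DegIdx (MatIdx c.m) c.m) K := fun a => S.F (c.rows.getD a 0)
  let q' : Fin c.r → MvPolynomial (MatIdx c.m) K := fun b =>
    linSubst (MatIdx c.m) K (S.γ (c.cols.getD b 0)) (paddedPerFormLex K c.n c.m)
  have hq' : ∀ b, q' b ∈ orbitClosure (paddedPerFormLex K c.n c.m) := fun b =>
    linSubst_mem_orbitClosure _ _
  have hrow_mem : ∀ a : Fin c.r, c.rows.getD a 0 ∈ c.rows := fun a => by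
    rw [List.getD_eq_getElem _ _ a.isLt]; exact List.getElem_mem _
  have hcol_mem : ∀ b : Fin c.r, c.cols.getD b 0 ∈ c.cols := fun b => by
    rw [List.getD_eq_getElem _ _ (by rw [← hrc]; exact b.isLt)]; exact List.getElem_mem _
  have hF' : ∀ a, F' a ∈ highestWeightSpace (coordRep (MatIdx c.m) K c.m) χ :=
    fun a => S.mem _ (hrow_mem a)
  -- the evaluation matrix over `K` is the cast of the integer matrix
  have hM : (Matrix.of fun a b => aeval (formCoeff c.m (q' b)) (F' a)) =
      (Int.castRingHom K).mapMatrix c.intMinor := by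
    ext a b
    rw [Matrix.of_apply, RingHom.mapMatrix_apply, Matrix.map_apply, intMinor, Matrix.of_apply,
      S.eval_eq _ (hrow_mem a) _ (hcol_mem b), eq_intCast]
  have hdet : (Matrix.of fun a b => aeval (formCoeff c.m (q' b)) (F' a)).det ≠ 0 := by
    rw [hM, ← RingHom.map_det, eq_intCast, Int.cast_ne_zero]
    exact c.det_intMinor_ne_zero h
  exact le_orbitMultiplicity_of_det_eval_ne_zero_of_mem_orbitClosure hm
    (paddedPerFormLex_isHomogeneous K hnm) (paddedPerFormLex_ne_zero K c.n c.m) F' hF' q' hq' hdet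

/-- **A verified certificate plus its semantics plus the det-side number is an obstruction in
symmetric Kronecker form** `PerDetSymKroneckerObstructionAt n m d λ` (tree statement:
`sk(λ, m×d) < mult_{λ^*} K[Δ(X₀₀^{m-n} per_n)]`, `n ≤ m`, `ℓ(λ) ≤ m²`). [folklore] -/
theorem perDetSymKroneckerObstructionAt_of_verify (c : Cert) [NeZero c.m] {K : Type} [Field K]
    [CharZero K] (h : c.verify = true) {hpos : ∀ a ∈ c.lam, 0 < a} {hsum : c.lam.sum = c.m * c.d}
    (S : c.Semantics K (c.weight hpos hsum))
    (hsk : symKroneckerCoeffRect K c.m c.d (c.lamPartition hpos hsum) ≤ c.sk) :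
    PerDetSymKroneckerObstructionAt (k := K) c.n c.m c.d (c.lamPartition hpos hsum) := by
  have hS := c.spec_of_structural (c.structural_of_verify h)
  refine ⟨hS.2.1, ?_, ?_⟩
  · rw [card_lamPartition]; exact hS.2.2.1
  · exact lt_of_le_of_lt hsk (lt_of_lt_of_le hS.2.2.2.2.2.2.2.2 (c.le_orbitMultiplicity_of_verify S h))

/-- **… hence a multiplicity obstruction** `PerDetMultiplicityObstructionAt n m d λ`, by the tree's
PROVED det-side bound `mult_{λ^*} K[Δ(det_m)] ≤ sk(λ, m×d)` (BLMW 2011 Prop. 5.2.1;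
`PerDetSymKroneckerObstructionAt.perDetMultiplicityObstructionAt`). [folklore] -/
theorem perDetMultiplicityObstructionAt_of_verify (c : Cert) [NeZero c.m] {K : Type} [Field K]
    [CharZero K] (h : c.verify = true) {hpos : ∀ a ∈ c.lam, 0 < a} {hsum : c.lam.sum = c.m * c.d}
    (S : c.Semantics K (c.weight hpos hsum))
    (hsk : symKroneckerCoeffRect K c.m c.d (c.lamPartition hpos hsum) ≤ c.sk) :
    PerDetMultiplicityObstructionAt (k := K) c.n c.m c.d (c.lamPartition hpos hsum) :=
  (c.perDetSymKroneckerObstructionAt_of_verify h S hsk).perDetMultiplicityObstructionAt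

/-- **… and hence `m < dc(per_n)`** (Ikenmeyer–Panova 2017 Thm. 1.3 / BLMW 2011 §5.7 as proved in
the tree, `lt_determinantalComplexity_perPoly_of_perDetMultiplicityObstructionAt`). Conditional
on `Semantics` (H1) and the det-side number (H2); the kernel-verified part is the arithmetic of
`verify`. [folklore] -/
theorem lt_determinantalComplexity_of_verify (c : Cert) [NeZero c.m] {K : Type} [Field K]
    [CharZero K] (h : c.verify = true) {hpos : ∀ a ∈ c.lam, 0 < a} {hsum : c.lam.sum = c.m * c.d}
    (S : c.Semantics K (c.weight hpos hsum))
    (hsk : symKroneckerCoeffRect K c.m c.d (c.lamPartition hpos hsum) ≤ c.sk) :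
    c.m < determinantalComplexity (perPoly (Fin c.n) K) :=
  lt_determinantalComplexity_perPoly_of_perDetMultiplicityObstructionAt
    (c.perDetMultiplicityObstructionAt_of_verify h S hsk)

end Cert

end TableauEval

end Literature.Computability.AlgebraicComplexity
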